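import Summits.AtomisticToContinuum.BoseEinsteinCondensation.Theorems.BECThomsonPrincipleGDTransferSeededCompactDefs
import Summits.AtomisticToContinuum.BoseEinsteinCondensation.Theorems.PeriodicIRBound.Negative.AEClass
import HarnessLib

/-!
# Route `BECThomsonPrinciple`, crux `GDTransfer` (stmt-AtomisticToContinuum-9482), line `seeded-continuity`
# (skeleton v8): stub `stub_aeDilationL1` — a.e. convergence of the dilated pair interactions along a subsequence

Statement (A) `AEDilationL1` of `BECThomsonPrincipleGDTransferSeededCompactDefs.lean`: for an admissible
profile `v` (measurable, range `R₀`) that is finite on `[0, ∞)` with integrable lift `x ↦ v(|x|)` on `ℝ³`, a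
side `L > 0`, a particle number `N` and any sequence of dilation parameters `b_k > 0`, `b_k → 1`, some
subsequence `b_{φ(k)}` has
`Σ_{i<j} (b⁻²v(·/b))^per(Xᵢ − Xⱼ) → Σ_{i<j} v^per(Xᵢ − Xⱼ)` (`b = b_{φ(k)}`, `k → ∞`) for Lebesgue-a.e.
configuration `X ∈ (ℝ³)^N`.

Proof.
1. The real lift `F(x) = v(|x|).toReal` is integrable (`integrable_toReal_of_lintegral_ne_top`), and the real
   dilates `G_k(x) = b_k⁻² F(x/b_k)` converge to `F` in `L¹(ℝ³)` by the continuity of dilations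
   `dil_integral_dilate_sub_le` (landed with `stub_dilationL1`); hence in measure
   (`MeasureTheory.tendstoInMeasure_of_tendsto_eLpNorm`, `p = 1`), hence a.e. along a subsequence
   (`MeasureTheory.TendstoInMeasure.exists_seq_tendsto_ae`) — `aedil_exists_seq_tendsto_ae`.
2. Dictionary `b⁻²v(|x|/b) = ENNReal.ofReal (G(x))`, `v(|x|) = ENNReal.ofReal (F x)` (finiteness on `[0, ∞)`),
   so the scaled profiles converge a.e. on `ℝ³` (`aedil_tendsto_scaledPotential`).
3. Lebesgue measure is translation invariant, so the same holds at every lattice translate `x − Ln`,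
   simultaneously for the countably many `n ∈ ℤ³` (`ae_all_iff`); for `b ≤ 2` all scaled profiles vanish
   beyond `R = 2·max R₀ 0`, and only the finitely many images within `R` of `x` contribute
   (`PairBound.exists_images_finset`, `tsum_eq_sum`), so the periodisations converge a.e.
   (`tendsto_finsetSum`; `aedil_ae_tendsto_periodizedPotential`).
4. Pair differences are quasi-measure-preserving on `(ℝ³)^N` (`Negative.ae_pairDiff`), so the finitely many
   pair terms converge simultaneously for a.e. configuration, and so does their sum (`stub_aeDilationL1`).

References: LSSY2005 Ch. 5, footnote to (5.3) (scaling); everything here is proved from Mathlib and the tree.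
-/

noncomputable section

open MeasureTheory Filter Set Metric
open scoped ENNReal NNReal Topology

namespace Summit.AtomisticToContinuum.BoseEinsteinCondensation.Cruxes.GDTransfer.Seeded

open Literature.MathematicalPhysics.QuantumManyBody.BoseGas
open Literature.Barriers.AtomisticToContinuum.BoseGas (scaledPotential)
open Summit.AtomisticToContinuum.BoseEinsteinCondensation.Theorems.PeriodicIRBound.Negative (ae_pairDiff)

/-! ## §1 From `L¹`-continuity of dilations to an a.e.-convergent subsequence -/

/-- **A.e.-convergent subsequence of the real dilates.**  For an integrable `F : ℝ³ → ℝ` and dilation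
parameters `b_k > 0`, `b_k → 1`, some subsequence of `G_k(x) = b_k⁻² F(x/b_k)` converges to `F(x)` for a.e.
`x`: `‖G_k − F‖₁ → 0` by `dil_integral_dilate_sub_le`, so `G_k → F` in measure, and a subsequence converges
a.e. (Riesz). [folklore] -/
theorem aedil_exists_seq_tendsto_ae {F : Space → ℝ} (hF : Integrable F) {b : ℕ → ℝ}
    (hb0 : ∀ k, 0 < b k) (hb : Tendsto b atTop (𝓝 1)) :
    ∃ φ : ℕ → ℕ, StrictMono φ ∧ ∀ᵐ x : Space,
      Tendsto (fun k => (b (φ k) ^ 2)⁻¹ * F ((b (φ k))⁻¹ • x)) atTop (𝓝 (F x)) := by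
  set G : ℕ → Space → ℝ := fun k x => (b k ^ 2)⁻¹ * F ((b k)⁻¹ • x) with hG
  have hGi : ∀ k, Integrable (G k) := fun k =>
    (hF.comp_smul (inv_ne_zero (hb0 k).ne')).const_mul _
  -- `L¹` convergence
  have hL1 : Tendsto (fun k => eLpNorm (G k - F) 1 volume) atTop (𝓝 0) := by
    rw [ENNReal.tendsto_nhds_zero]
    intro ε hε
    rcases eq_or_ne ε ⊤ with hεt | hεt
    · exact Eventually.of_forall fun k => hεt ▸ le_top
    have hη : 0 < ε.toReal := ENNReal.toReal_pos hε.ne' hεt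
    obtain ⟨ϑ, hϑ, hclose⟩ := dil_integral_dilate_sub_le hF hη
    filter_upwards [Metric.tendsto_nhds.1 hb ϑ hϑ] with k hk
    rw [Real.dist_eq] at hk
    have hI : Integrable (G k - F) := (hGi k).sub hF
    rw [eLpNorm_one_eq_lintegral_enorm, ← ofReal_integral_norm_eq_lintegral_enorm hI,
      ← ENNReal.ofReal_toReal hεt]
    refine ENNReal.ofReal_le_ofReal ?_
    simpa only [Pi.sub_apply, Real.norm_eq_abs, hG] using hclose (b k) hk
  -- convergence in measure, then a.e. along a subsequence
  have hmeas : TendstoInMeasure volume G atTop F :=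
    tendstoInMeasure_of_tendsto_eLpNorm one_ne_zero (fun k => (hGi k).aestronglyMeasurable)
      hF.aestronglyMeasurable hL1
  exact hmeas.exists_seq_tendsto_ae

/-! ## §2 The `ℝ≥0∞` dictionary and a.e. convergence of the scaled profiles -/

/-- The scaled profile at radius `|x|` is `ENNReal.ofReal` of the real dilate of the lift (`v` finite on
`[0, ∞)`, `c > 0`): `c⁻²v(|x|/c) = ofReal (c⁻² · v(|x/c|).toReal)`. [folklore] -/
theorem aedil_scaledPotential_norm_eq {v : ℝ → ℝ≥0∞} (hfin : ∀ r, 0 ≤ r → v r ≠ ⊤) {c : ℝ}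
    (hc : 0 < c) (x : Space) :
    scaledPotential v c ‖x‖ = ENNReal.ofReal ((c ^ 2)⁻¹ * (v ‖c⁻¹ • x‖).toReal) := by
  have hn : ‖c⁻¹ • x‖ = ‖x‖ / c := by
    rw [norm_smul, norm_inv, Real.norm_of_nonneg hc.le, div_eq_inv_mul]
  rw [hn, ENNReal.ofReal_mul (inv_nonneg.2 (sq_nonneg c)), ENNReal.ofReal_inv_of_pos (by positivity),
    ENNReal.ofReal_toReal (hfin _ (div_nonneg (norm_nonneg _) hc.le))]
  rfl

/-- **Pointwise transfer.**  If the real dilates `c_k⁻² v(|x/c_k|).toReal` converge to `v(|x|).toReal`, then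
the scaled profiles `c_k⁻² v(|x|/c_k)` converge to `v(|x|)` in `ℝ≥0∞` (`v` finite on `[0, ∞)`, `c_k > 0`;
continuity of `ENNReal.ofReal`). [folklore] -/
theorem aedil_tendsto_scaledPotential {v : ℝ → ℝ≥0∞} (hfin : ∀ r, 0 ≤ r → v r ≠ ⊤) {c : ℕ → ℝ}
    (hc : ∀ k, 0 < c k) {x : Space}
    (hx : Tendsto (fun k => (c k ^ 2)⁻¹ * (v ‖(c k)⁻¹ • x‖).toReal) atTop (𝓝 (v ‖x‖).toReal)) :
    Tendsto (fun k => scaledPotential v (c k) ‖x‖) atTop (𝓝 (v ‖x‖)) := by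
  have h := ENNReal.tendsto_ofReal hx
  rw [ENNReal.ofReal_toReal (hfin _ (norm_nonneg _))] at h
  refine h.congr fun k => ?_
  exact (aedil_scaledPotential_norm_eq hfin (hc k) x).symm

/-! ## §3 Periodisation: countably many translates, finitely many images -/

/-- **A.e. convergence of the periodisations.**  If the scaled profiles `c_k⁻²v(|x|/c_k)` converge to
`v(|x|)` for a.e. `x ∈ ℝ³` (`v` of range `R₀`, `c_k > 0`, `c_k → 1`, `L > 0`), then
`(c_k⁻²v(·/c_k))^per(x) → v^per(x)` for a.e. `x`: translation invariance of Lebesgue measure puts the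
convergence at every lattice translate `x − Ln` simultaneously (`ae_all_iff`), and once `c_k < 2` only the
finitely many images with `‖x − Ln‖ ≤ 2·max R₀ 0` contribute (`PairBound.exists_images_finset`). [folklore] -/
theorem aedil_ae_tendsto_periodizedPotential {v : ℝ → ℝ≥0∞} {R₀ : ℝ} (hR₀ : ∀ r, R₀ < r → v r = 0)
    {L : ℝ} (hL : 0 < L) {c : ℕ → ℝ} (hc : ∀ k, 0 < c k) (hc1 : Tendsto c atTop (𝓝 1))
    (h : ∀ᵐ x : Space, Tendsto (fun k => scaledPotential v (c k) ‖x‖) atTop (𝓝 (v ‖x‖))) :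
    ∀ᵐ x : Space, Tendsto (fun k => periodizedPotential (scaledPotential v (c k)) L x) atTop
      (𝓝 (periodizedPotential v L x)) := by
  -- all lattice translates at once
  have hn : ∀ n : Fin 3 → ℤ, ∀ᵐ x : Space, Tendsto (fun k => scaledPotential v (c k) ‖x - latticeVec L n‖)
      atTop (𝓝 (v ‖x - latticeVec L n‖)) := fun n =>
    (measurePreserving_sub_right (volume : Measure Space) (latticeVec L n)).quasiMeasurePreserving.ae h
  -- eventually `c k < 2`
  have hc2 : ∀ᶠ k in atTop, c k < 2 := hc1.eventually (eventually_lt_nhds (by norm_num : (1 : ℝ) < 2))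
  -- uniformly finitely many images within `R := 2 * max R₀ 0`
  set R : ℝ := 2 * max R₀ 0 with hRdef
  obtain ⟨_, hS⟩ := PairBound.exists_images_finset hL R
  filter_upwards [ae_all_iff.2 hn] with x hx
  obtain ⟨S, -, hSfar⟩ := hS x
  -- far images vanish, for `v` and for the scaled profiles with `c < 2`
  have hfar_v : ∀ n ∉ S, v ‖x - latticeVec L n‖ = 0 := fun n hn => by
    refine hR₀ _ (lt_of_le_of_lt ?_ (hSfar n hn))
    rw [hRdef]
    have := le_max_left R₀ 0
    have := le_max_right R₀ 0
    linarith
  have hfar_c : ∀ k, c k < 2 → ∀ n ∉ S, scaledPotential v (c k) ‖x - latticeVec L n‖ = 0 := by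
    intro k hk n hn
    have hr := hSfar n hn
    simp only [scaledPotential]
    rw [hR₀ _ ?_, mul_zero]
    rw [lt_div_iff₀ (hc k)]
    calc R₀ * c k ≤ max R₀ 0 * c k := mul_le_mul_of_nonneg_right (le_max_left _ _) (hc k).le
      _ ≤ max R₀ 0 * 2 := mul_le_mul_of_nonneg_left hk.le (le_max_right _ _)
      _ = R := by rw [hRdef]; ring
      _ < ‖x - latticeVec L n‖ := hr
  have hlim : Tendsto (fun k => ∑ n ∈ S, scaledPotential v (c k) ‖x - latticeVec L n‖) atTop
      (𝓝 (∑ n ∈ S, v ‖x - latticeVec L n‖)) :=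
    tendsto_finsetSum S fun n _ => hx n
  have hv_eq : periodizedPotential v L x = ∑ n ∈ S, v ‖x - latticeVec L n‖ := tsum_eq_sum hfar_v
  rw [hv_eq]
  refine hlim.congr' ?_
  filter_upwards [hc2] with k hk
  exact (tsum_eq_sum (hfar_c k hk)).symm

/-! ## §4 The stub -/

/-- **Stub `stub_aeDilationL1` (statement (A) `AEDilationL1`).**  For an admissible profile `v` finite on
`[0, ∞)` with integrable lift, `N`, `L > 0` and dilation parameters `b_k > 0`, `b_k → 1`, a subsequence
`φ` has `Σ_{i<j} (b⁻²v(·/b))^per(Xᵢ − Xⱼ) → Σ_{i<j} v^per(Xᵢ − Xⱼ)` along `b = b_{φ(k)}` for a.e.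
configuration `X`: §1–§3 on `ℝ³`, pulled back to the pair differences by `Negative.ae_pairDiff` and summed
over the finitely many pairs. -/
theorem stub_aeDilationL1 : Sig.stub_aeDilationL1 := by
  intro v hv hfin hint N L hL b hb0 hb1
  obtain ⟨hmeas, R₀, hR₀⟩ := hv
  -- the real lift is integrable; extract the subsequence on `ℝ³`
  have hF : Integrable (fun x : Space => (v ‖x‖).toReal) :=
    integrable_toReal_of_lintegral_ne_top (hmeas.comp measurable_norm).aemeasurable hint
  obtain ⟨φ, hφ, hae⟩ := aedil_exists_seq_tendsto_ae hF hb0 hb1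
  refine ⟨φ, hφ, ?_⟩
  have hc : ∀ k, 0 < b (φ k) := fun k => hb0 _
  have hc1 : Tendsto (fun k => b (φ k)) atTop (𝓝 1) := hb1.comp hφ.tendsto_atTop
  -- a.e. convergence of the scaled profiles on `ℝ³`
  have h1 : ∀ᵐ x : Space, Tendsto (fun k => scaledPotential v (b (φ k)) ‖x‖) atTop (𝓝 (v ‖x‖)) := by
    filter_upwards [hae] with x hx
    exact aedil_tendsto_scaledPotential hfin hc hx
  -- … of the periodisations
  have h2 := aedil_ae_tendsto_periodizedPotential hR₀ hL hc hc1 h1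
  -- … of every pair term, on configuration space
  have hpair : ∀ i j : Fin N, ∀ᵐ X : Config N, i ≠ j →
      Tendsto (fun k => periodizedPotential (scaledPotential v (b (φ k))) L (X i - X j)) atTop
        (𝓝 (periodizedPotential v L (X i - X j))) := by
    intro i j
    by_cases hij : i = j
    · exact Eventually.of_forall fun X h => absurd hij h
    · filter_upwards [ae_pairDiff hij h2] with X hX _ using hX
  filter_upwards [ae_all_iff.2 fun i => ae_all_iff.2 (hpair i)] with X hX
  unfold periodicInteraction
  refine tendsto_finsetSum _ fun i _ => tendsto_finsetSum _ fun j hj => ?_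
  rw [Finset.mem_filter] at hj
  exact hX i j (ne_of_lt hj.2)

end Summit.AtomisticToContinuum.BoseEinsteinCondensation.Cruxes.GDTransfer.Seeded

end
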